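import Summits.BirchSwinnertonDyer.BirchSwinnertonDyer.Theorems.PrintCFramBottomClassIndexLawFiveLeHerbrandKummerReflectionCountCharacters
import Summits.BirchSwinnertonDyer.BirchSwinnertonDyer.Theorems.PrintCFramBottomClassIndexLawFiveLeHerbrandOddUnramifiedCount
import Summits.BirchSwinnertonDyer.BirchSwinnertonDyer.Theorems.PrintCFramBottomClassIndexLawFiveLeHerbrandOddVanishingUnconditional
import HarnessLib

/-!
# Route `PrintCFram`, crux C2 `BottomClassIndexLawFiveLe` (stmt-BirchSwinnertonDyer-20372), line
# `eisenstein-resource-bdp-line` (registry v19): **THE MAZUR–WILES DICTIONARY OF THE TWO COUNTS** — under Mazur–Wiles Thm. 2,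
# `#e_ψ(ℤ_p ⊗ Cl) = p^{v_p(B_{1,χ⁻¹})}`, so both residual groups of the B1 Selmer count have order `≤ p^{v_p(B_{1,ψ⁻¹})}`
# (cell `bsd-print-cfram`, width seat `bsd-line-cfram-p1-w7` g3; helper `--supports` 20372; 0 defs, 0 facts, 0 sorry)

HONEST FRAMING. Nothing about BSD is proved here, no stub is closed; CONDITIONAL on the Literature named fact
`MazurWiles1984.thm2_card_oddChiClassGroup_eq_bernoulli` (taken as the hypothesis `hMW`, exactly as in the cell's (β) lane). The
two counting engines (`HerbrandKummer.finite_and_natCard_le_classGroupChiCard_of_characters`, p674194 — EVEN character,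
ramification at `p` allowed; `HerbrandOddClassGroup.finite_and_natCard_le_classGroupChiCard_of_unramified_characters`, p674608 — any
character, everywhere unramified) bound a group of `𝔽_p`-characters by `classGroupChiCard ℚ K p θ = #e_θ(ℤ_p ⊗ Cl_K)`; Mazur–Wiles turns
that into `‖B_{1,χ⁻¹}‖_p⁻¹` for the Dirichlet avatar `χ` of `θ`. This file records the composites in the socket-ready form
«`Finite V ∧ #V ≤ p^v`» from «`‖B_{1,χ⁻¹}‖_p = p^{−v}`» (on both inhabited off-locus window members `v = 1`, so each side is `≤ p` and
CASE S of the φ-descent count gives `#Sel_p(W/ℚ) ≤ p²` — w2 g9's files II–IV supply the Galois-cohomology side).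

* `classGroupChiCard_eq_pow_of_norm_bernoulli_eq` — `hMW` ⟹ `classGroupChiCard ℚ K p ψ = p^v` when `‖B_{1,χ⁻¹}‖_p = p^{−v}`.
* **`finite_and_natCard_le_pow_of_characters_of_mazurWiles`** (EVEN side) and
  **`finite_and_natCard_le_pow_of_unramified_characters_of_mazurWiles`** (ODD side).

THEOREMS ONLY; no definition, no named fact, no `sorry`; imports no `Theses` module. BSD is not proved by any of this; no summit
statement is proved by this seat. References: [MazurWiles1984] Thm. 2 (p. 216) via [Solomon1990] §I p. 468; [Washington1997] §10.2.
-/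

set_option autoImplicit false
-- `…BirchSwinnertonDyer.BirchSwinnertonDyer.Theorems…` is the problem's mandated namespace (D-0017).
set_option linter.dupNamespace false

noncomputable section

namespace Summit.BirchSwinnertonDyer.BirchSwinnertonDyer.Theorems.PrintCFram.HerbrandReflectionCount

open Literature.NumberTheory.NumberFields Literature.NumberTheory.GaloisRepresentations
open Literature.NumberTheory.EllipticCurves Literature.NumberTheory.EllipticCurves.Kato2004
open NumberField NumberField.IsCMField IsDedekindDomain Field DirichletCharacter
open scoped nonZeroDivisors Pointwise

variable {p : ℕ} [Fact p.Prime] {K : Type} [Field K] [NumberField K]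

/-- **`#e_ψ(ℤ_p ⊗ Cl(K)) = p^v` when `‖B_{1,χ⁻¹}‖_p = p^{−v}`** (Mazur–Wiles Thm. 2, `hMW`): `K/ℚ` abelian with `p ∤ [K:ℚ]`, `p` odd,
`χ` a primitive odd `ℚ_p`-valued Dirichlet character, not the Teichmüller character, `ψ : Gal(K/ℚ) → ℤ_pˣ` its Galois avatar.
[cite: MazurWiles1984, Thm. 2 (p. 216) — statement via Solomon1990, §I pp. 467–468] -/
theorem classGroupChiCard_eq_pow_of_norm_bernoulli_eq (hMW : MazurWiles1984.thm2_card_oddChiClassGroup_eq_bernoulli)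
    (hp2 : p ≠ 2) [IsAbelianGalois ℚ K] (hpK : ¬ p ∣ Module.finrank ℚ K)
    {f : ℕ} [NeZero f] {χ : DirichletCharacter ℚ_[p] f} (hprim : χ.IsPrimitive) (hodd : χ.Odd)
    (hχω : ¬ ∀ a : ℤ, ¬ ((p : ℤ) ∣ a) → ‖χ (a : ZMod f) - (a : ℚ_[p])‖ < 1)
    {ψ : (K ≃ₐ[ℚ] K) →* ℤ_[p]ˣ}
    (hψχ : ∀ τ : absoluteGaloisGroup ℚ,
      (((ψ (absGaloisQuot ℚ K τ) : ℤ_[p]ˣ) : ℤ_[p]) : ℚ_[p]) = χ ((modNCyclotomicCharacter ℚ f τ : (ZMod f)ˣ) : ZMod f))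
    {v : ℕ} (hB : ‖KrizLi2019.bernoulliOnePrim χ⁻¹‖ = ((p : ℝ) ^ v)⁻¹) :
    classGroupChiCard ℚ K p (fun σ => ((ψ σ : ℤ_[p]ˣ) : ℤ_[p])) = p ^ v := by
  have hcard := hMW p hp2 K hpK f χ hprim hodd hχω ψ hψχ
  rw [hB, inv_inv] at hcard
  exact_mod_cast hcard

/-- **EVEN SIDE: `#V ≤ p^{v_p(B_{1,ψ⁻¹})}` under Mazur–Wiles.** The binders of `HerbrandKummer.absGaloisHom_eq_one_of_even_unconditional`
(`K` CM abelian `∋ ζ_p`, `p` odd, `p ∤ [K:ℚ]`, `χ̄` EVEN `≠ 1`, `hdec`, `ψ̄ = ā χ̄⁻¹`, a primitive odd non-Teichmüller Dirichlet character `ψ`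
which is the avatar of `Teich ∘ ψ̄`), with `‖B_{1,ψ⁻¹}‖_p = p^{−v}` INSTEAD of `= 1`, and `hMW`: every subgroup `V` of characters
`κ : Γ_K → 𝔽_p` with open kernel, unramified outside `p`, and `χ̄`-equivariant is finite with `#V ≤ p^v` (`v = 0`: `κ = 1`, the engine).
[cite: MazurWiles1984, Thm. 2 (p. 216) — via Solomon1990, §I p. 468] [cite: Washington1997, §10.2 (proof of Thm. 10.9)] -/
theorem finite_and_natCard_le_pow_of_characters_of_mazurWiles
    (hMW : MazurWiles1984.thm2_card_oddChiClassGroup_eq_bernoulli)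
    [IsCMField K] [IsAbelianGalois ℚ K] (hp2 : p ≠ 2) (hpK : ¬ p ∣ Module.finrank ℚ K)
    {ζ : K} (hζ : IsPrimitiveRoot ζ p) (a : (K ≃ₐ[ℚ] K) → ℕ) (ha : ∀ σ : K ≃ₐ[ℚ] K, σ ζ = ζ ^ a σ)
    (χb : (K ≃ₐ[ℚ] K) →* (ZMod p)ˣ) (heven : χb ((complexConj K).restrictScalars ℚ) = 1) (hne1 : χb ≠ 1)
    (hdec : ∀ v : HeightOneSpectrum (𝓞 K), ((p : ℕ) : 𝓞 K) ∈ v.asIdeal →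
      ∃ σ : K ≃ₐ[ℚ] K, σ • v.asIdeal = v.asIdeal ∧
        ¬ ((a σ : ZMod p) * (((χb σ)⁻¹ : (ZMod p)ˣ) : ZMod p)) = 1)
    (ψb : (K ≃ₐ[ℚ] K) →* (ZMod p)ˣ)
    (hψb : ∀ σ : K ≃ₐ[ℚ] K, ((ψb σ : (ZMod p)ˣ) : ZMod p) = (a σ : ZMod p) * (((χb σ)⁻¹ : (ZMod p)ˣ) : ZMod p))
    {f : ℕ} [NeZero f] (ψ : DirichletCharacter ℚ_[p] f) (hprim : ψ.IsPrimitive)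
    (hθχ : ∀ τ : absoluteGaloisGroup ℚ,
      (((((teichmullerChar p).comp ψb) (absGaloisQuot ℚ K τ) : ℤ_[p]ˣ) : ℤ_[p]) : ℚ_[p]) =
        ψ ((modNCyclotomicCharacter ℚ f τ : (ZMod f)ˣ) : ZMod f)) (hodd : ψ.Odd)
    (hnotω : ¬ (f = p ∧ ∀ b : ℤ, ¬ ((p : ℤ) ∣ b) → ‖ψ (b : ZMod f) - (b : ℚ_[p])‖ < 1))
    {v : ℕ} (hB : ‖KrizLi2019.bernoulliOnePrim ψ⁻¹‖ = ((p : ℝ) ^ v)⁻¹)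
    (V : Subgroup (absoluteGaloisGroup K →* Multiplicative (ZMod p)))
    (hκ : ∀ κ ∈ V, IsOpen (κ.ker : Set (absoluteGaloisGroup K)))
    (hunr : ∀ κ ∈ V, ∀ w : HeightOneSpectrum (𝓞 K), ((p : ℕ) : 𝓞 K) ∉ w.asIdeal →
      ∀ 𝔓 ∈ w.primesAbove, ∀ g ∈ 𝔓.inertia (absoluteGaloisGroup K), κ g = 1)
    (heq : ∀ κ ∈ V, ∀ (γ : absoluteGaloisGroup ℚ) (σ : absoluteGaloisGroup K),
      κ (absGaloisOuterConj ℚ K γ σ) = κ σ ^ ((χb (absGaloisQuot ℚ K γ) : (ZMod p)ˣ) : ZMod p).val) :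
    Finite V ∧ Nat.card V ≤ p ^ v := by
  haveI : IsGalois ℚ K := IsAbelianGalois.toIsGalois
  have hχω := HerbrandOddClassGroup.not_forall_norm_sub_lt_one_of_not_teichmuller hp2 ψ hprim hnotω
  obtain ⟨hfin, hle⟩ := HerbrandKummer.finite_and_natCard_le_classGroupChiCard_of_characters hp2 hpK hζ a ha χb heven hne1
    hdec ψb hψb V hκ hunr heq
  exact ⟨hfin, hle.trans (classGroupChiCard_eq_pow_of_norm_bernoulli_eq hMW hp2 hpK hprim hodd hχω hθχ hB).le⟩

variable {L : Type} [Field L] [NumberField L]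

/-- **ODD SIDE: `#V ≤ p^{v_p(B_{1,χ⁻¹})}` under Mazur–Wiles.** `L/ℚ` abelian, `p` odd, `p ∤ [L:ℚ]`, `r : Γ_ℚ → (ℤ/p)ˣ`,
`θ : Gal(L/ℚ) → ℤ_pˣ` with `θ(τ̄) ≡ r(τ)` and Dirichlet avatar `χ` (primitive, odd, not Teichmüller) with `‖B_{1,χ⁻¹}‖_p = p^{−v}`, `hMW`:
every subgroup `V` of `r`-equivariant everywhere-unramified characters `κ : Γ_L → 𝔽_p` (open kernel) is finite with `#V ≤ p^v`
(`v = 0`: the engine `absGaloisHom_eq_one_final`). [cite: MazurWiles1984, Thm. 2 (p. 216) — via Solomon1990, §I p. 468]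
[cite: NeukirchANT1999, Ch. VI §7 Thm. (7.1)] -/
theorem finite_and_natCard_le_pow_of_unramified_characters_of_mazurWiles
    (hMW : MazurWiles1984.thm2_card_oddChiClassGroup_eq_bernoulli)
    [IsAbelianGalois ℚ L] (hp2 : p ≠ 2) (hpL : ¬ p ∣ Module.finrank ℚ L)
    (r : absoluteGaloisGroup ℚ →* (ZMod p)ˣ) (θ : (L ≃ₐ[ℚ] L) →* ℤ_[p]ˣ)
    (hθ : ∀ τ : absoluteGaloisGroup ℚ,
      PadicInt.toZMod ((θ (absGaloisQuot ℚ L τ) : ℤ_[p]ˣ) : ℤ_[p]) = ((r τ : (ZMod p)ˣ) : ZMod p))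
    {f : ℕ} [NeZero f] {χ : DirichletCharacter ℚ_[p] f} (hprim : χ.IsPrimitive) (hodd : χ.Odd)
    (hχω : ¬ ∀ a : ℤ, ¬ ((p : ℤ) ∣ a) → ‖χ (a : ZMod f) - (a : ℚ_[p])‖ < 1)
    (hθχ : ∀ τ : absoluteGaloisGroup ℚ,
      (((θ (absGaloisQuot ℚ L τ) : ℤ_[p]ˣ) : ℤ_[p]) : ℚ_[p]) = χ ((modNCyclotomicCharacter ℚ f τ : (ZMod f)ˣ) : ZMod f))
    {v : ℕ} (hB : ‖KrizLi2019.bernoulliOnePrim χ⁻¹‖ = ((p : ℝ) ^ v)⁻¹)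
    (V : Subgroup (absoluteGaloisGroup L →* Multiplicative (ZMod p)))
    (hκ : ∀ κ ∈ V, IsOpen (κ.ker : Set (absoluteGaloisGroup L)))
    (hunr : ∀ κ ∈ V, ∀ (w : HeightOneSpectrum (𝓞 L)) (𝔓 : Ideal (absIntegers (𝓞 L) L)), 𝔓 ∈ w.primesAbove →
      ∀ g ∈ 𝔓.inertia (absoluteGaloisGroup L), κ g = 1)
    (heq : ∀ κ ∈ V, ∀ (γ : absoluteGaloisGroup ℚ) (σ : absoluteGaloisGroup L),
      κ (absGaloisOuterConj ℚ L γ σ) = (κ σ) ^ ((r γ : (ZMod p)ˣ) : ZMod p).val) :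
    Finite V ∧ Nat.card V ≤ p ^ v := by
  haveI : IsGalois ℚ L := IsAbelianGalois.toIsGalois
  obtain ⟨hfin, hle⟩ :=
    HerbrandOddClassGroup.finite_and_natCard_le_classGroupChiCard_of_unramified_characters hp2 hpL r θ hθ V hκ hunr heq
  exact ⟨hfin, hle.trans (classGroupChiCard_eq_pow_of_norm_bernoulli_eq hMW hp2 hpL hprim hodd hχω hθχ hB).le⟩

end Summit.BirchSwinnertonDyer.BirchSwinnertonDyer.Theorems.PrintCFram.HerbrandReflectionCount

end
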